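import Mathlib
import HarnessLib
import Literature.RingTheory.CohomologyAnnihilator.Completion
import Literature.RingTheory.CohomologyAnnihilator.ModuleDescentFiniteSubextension
import Literature.AlgebraicGeometry.Resolution.AffineDomainDimension
import Literature.AlgebraicGeometry.Resolution.BlowupDimension
import Literature.AlgebraicGeometry.Resolution.NormalSurfaceSingularLocus
import Summits.ResolutionOfSingularities.ResolutionOfSingularities.Theorems.SyzygyFlatteningRankOneTerminationR1OfNormal

/-!
# Route `HomologicalConductor`, support `SurfaceTermination` (stmt-ResolutionOfSingularities-16488):
# the singular points of the normalised chart — finitely many, closed, over the closed point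

`[OURS · L W4.4]` Cell res-hironaka, crux chain W4.4, kill test K4.4-s; U2e-prep of res-L0-w44-stub-4: the
set `S` of «bad points» fed to the good cover (`…SurfaceTerminationGoodCover.exists_affineCover_eq_and_disjoint`)
in the (S)-step of `stub_pgNonincreasing`.  Nothing here is a statement of the manuscript under review
(Hironaka 2017); AI-written, weaker than expert review.

For a Noetherian integrally closed domain `N`:

* `two_le_height_of_not_isRegularLocalRing` — a prime `𝔫` with `N_𝔫` singular has height `≥ 2`
  (normal ⇒ (R₁): `N_𝔫` is a normal Noetherian local domain, regular when of dimension `≤ 1`, tree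
  `isRegularLocalRing_of_isIntegrallyClosed_of_ringKrullDim_le_one`);
* `under_eq_maximalIdeal_of_not_isRegularLocalRing` — if moreover `N` is a finitely generated ALGEBRAIC
  extension of a Noetherian local domain `T` of dimension `≤ 2` (e.g. `T ⊆ N ⊆ Frac T`), every singular
  prime of `N` lies over the maximal ideal of `T` (dimension inequality `ht 𝔫 ≤ ht (𝔫 ∩ T)`, tree
  `height_le_height_of_liesOver_of_finiteType_of_isAlgebraic`, Matsumura 15.5);
* `isMaximal_of_not_isRegularLocalRing` — for `dim N ≤ 2` singular primes are maximal (tree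
  `SyzygyFlattening.stub_R1_of_normal`);
* `ca_le_iff_not_isRegularLocalRing`, `finite_setOf_not_isRegularLocalRing` — for `N` essentially of finite
  type over a field and `dim N ≤ 2`, the singular primes are exactly the primes containing the cohomology
  annihilator (Iyengar–Takahashi 5.4, tree `singEqVCa_essFiniteType_holds`) and they are FINITELY MANY (all
  are minimal over `ca N`);
* scheme form on `Spec N`: `mem_regularLocus_Spec_iff`, `finite_compl_regularLocus_Spec`,
  `isClosed_singleton_of_not_mem_regularLocus_Spec`, `specMap_apply_eq_closedPoint_of_not_mem_regularLocus`;
* `isClosed_singleton_of_isLocallyClosed_of_apply_eq` — over a CLOSED point of the target, a locally closed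
  point of a scheme locally of finite type is closed (Jacobson fibre; Mathlib `JacobsonSpace (f.fiber y)`).

References: Iyengar–Takahashi, IMRN (2016), Thm. 5.4 [`IyengarTakahashi2014`]; Matsumura, *Commutative Ring
Theory*, Thm. 15.5, Thm. 11.2 [`Matsumura1987`].
-/

noncomputable section
set_option linter.dupNamespace false

namespace Summit.ResolutionOfSingularities.ResolutionOfSingularities.Theorems.SurfaceTermination.GenusDescent

open CategoryTheory AlgebraicGeometry TopologicalSpace IsLocalRing
open Literature.AlgebraicGeometry.Resolution
open Literature.RingTheory.CohomologyAnnihilator (ca singEqVCa_essFiniteType_holds)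

/-! ## Singular primes of a normal Noetherian domain -/

section Normal

variable {N : Type} [CommRing N] [IsDomain N] [IsNoetherianRing N] [IsIntegrallyClosed N]

/-- **Normal ⇒ (R₁)**: a prime `𝔫` of a Noetherian integrally closed domain with `N_𝔫` NOT regular has
height `≥ 2`. [cite: Matsumura1987, Thm. 11.2] -/
theorem two_le_height_of_not_isRegularLocalRing (𝔫 : Ideal N) [𝔫.IsPrime]
    (h : ¬ IsRegularLocalRing (Localization.AtPrime 𝔫)) : (2 : ℕ∞) ≤ 𝔫.height := by
  by_contra hlt
  apply h
  haveI : IsIntegrallyClosed (Localization.AtPrime 𝔫) :=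
    isIntegrallyClosed_of_isLocalization (Localization.AtPrime 𝔫) 𝔫.primeCompl
      𝔫.primeCompl_le_nonZeroDivisors
  refine isRegularLocalRing_of_isIntegrallyClosed_of_ringKrullDim_le_one _ ?_
  rw [IsLocalization.AtPrime.ringKrullDim_eq_height 𝔫]
  have h1 : 𝔫.height ≤ 1 := by
    have h2 : 𝔫.height < 2 := not_le.mp hlt
    have : 𝔫.height < 1 + 1 := by simpa [one_add_one_eq_two] using h2
    exact Order.le_of_lt_add_one this
  exact_mod_cast h1

/-- For `dim N ≤ 2`: singular primes are MAXIMAL (primes that are not maximal have regular local rings,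
tree `SyzygyFlattening.stub_R1_of_normal`). [cite: Matsumura1987, Thm. 11.2] -/
theorem isMaximal_of_not_isRegularLocalRing (hdim : ringKrullDim N ≤ 2) (𝔫 : Ideal N) [𝔫.IsPrime]
    (h : ¬ IsRegularLocalRing (Localization.AtPrime 𝔫)) : 𝔫.IsMaximal := by
  by_contra hmax
  exact h (SyzygyFlattening.stub_R1_of_normal N hdim ⟨𝔫, inferInstance⟩ hmax)

end Normal

/-! ## Singular primes lie over the closed point of the base -/

section OverBase

variable {T N : Type} [CommRing T] [CommRing N] [IsDomain T] [IsDomain N] [IsNoetherianRing T]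
  [IsNoetherianRing N] [IsLocalRing T] [IsIntegrallyClosed N] [Algebra T N] [FaithfulSMul T N]
  [Algebra.FiniteType T N] [Algebra.IsAlgebraic T N]

/-- **Singular primes of `N` lie over the maximal ideal of `T`** when `N ⊇ T` is a finitely generated
algebraic extension of domains (e.g. `T ⊆ N ⊆ Frac T`) with `N` normal and `dim T ≤ 2`:
`ht 𝔫 ≥ 2` and `ht 𝔫 ≤ ht (𝔫 ∩ T)` (dimension inequality) force `𝔫 ∩ T = 𝔪_T`.
[cite: Matsumura1987, Thm. 15.5] -/
theorem under_eq_maximalIdeal_of_not_isRegularLocalRing (hT : ringKrullDim T ≤ 2) (𝔫 : Ideal N)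
    [𝔫.IsPrime] (h : ¬ IsRegularLocalRing (Localization.AtPrime 𝔫)) :
    𝔫.under T = maximalIdeal T := by
  have h2 : (2 : ℕ∞) ≤ 𝔫.height := two_le_height_of_not_isRegularLocalRing 𝔫 h
  have hle : 𝔫.height ≤ (𝔫.under T).height :=
    height_le_height_of_liesOver_of_finiteType_of_isAlgebraic (𝔫.under T) 𝔫
  by_contra hne
  have hlt : 𝔫.under T < maximalIdeal T :=
    lt_of_le_of_ne (IsLocalRing.le_maximalIdeal (Ideal.IsPrime.ne_top inferInstance)) hne
  have h3 := Ideal.height_add_one_le_of_lt_of_isPrime hlt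
  have h4 : ((maximalIdeal T).height : WithBot ℕ∞) ≤ ((2 : ℕ∞) : WithBot ℕ∞) :=
    (Ideal.height_le_ringKrullDim_of_isPrime (I := maximalIdeal T)).trans hT
  have h4' : (maximalIdeal T).height ≤ 2 := WithBot.coe_le_coe.mp h4
  have hum : (𝔫.under T).height ≤ (maximalIdeal T).height := Ideal.height_mono hlt.le
  have h2ne : (2 : ℕ∞) ≠ ⊤ := by decide
  have hu_ne : (𝔫.under T).height ≠ ⊤ := ne_top_of_le_ne_top h2ne (hum.trans h4')
  have hlt' : (𝔫.under T).height < (maximalIdeal T).height := (ENat.add_one_le_iff hu_ne).mp h3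
  exact lt_irrefl _ (((h2.trans hle).trans_lt hlt').trans_le h4')

end OverBase

/-! ## Finiteness: singular primes are the primes over the cohomology annihilator -/

section Finite

variable (k : Type) [Field k] {N : Type} [CommRing N] [IsDomain N] [IsNoetherianRing N]
  [IsIntegrallyClosed N] [Algebra k N] [Algebra.EssFiniteType k N]

include k in
omit [IsNoetherianRing N] [IsIntegrallyClosed N] in
/-- **`Sing N = V(ca N)`** for `N` essentially of finite type over a field (Iyengar–Takahashi, Thm. 5.4,
tree `singEqVCa_essFiniteType_holds`, unpacked for the canonical presentation of `N` as a localisation of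
a finitely generated `k`-algebra). [cite: IyengarTakahashi2014, Thm. 5.4] -/
theorem ca_le_iff_not_isRegularLocalRing (𝔫 : Ideal N) [𝔫.IsPrime] :
    ca N ≤ 𝔫 ↔ ¬ IsRegularLocalRing (Localization.AtPrime 𝔫) := by
  obtain ⟨d, hd, -⟩ :=
    exists_ringKrullDim_eq_and_trdeg_eq k ↥(Algebra.EssFiniteType.subalgebra k N)
  exact (singEqVCa_essFiniteType_holds k ↥(Algebra.EssFiniteType.subalgebra k N) inferInstance d hd
    (Algebra.EssFiniteType.submonoid k N) N inferInstance 𝔫).1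

include k in
/-- **The singular primes of a normal surface essentially of finite type over a field are finitely
many**: they are exactly the minimal primes of `ca N` (each contains `ca N` and is maximal), of which a
Noetherian ring has finitely many. [cite: IyengarTakahashi2014, Thm. 5.4] -/
theorem finite_setOf_not_isRegularLocalRing (hdim : ringKrullDim N ≤ 2) :
    {𝔫 : PrimeSpectrum N | ¬ IsRegularLocalRing (Localization.AtPrime 𝔫.asIdeal)}.Finite := by
  have hsub : {𝔫 : PrimeSpectrum N | ¬ IsRegularLocalRing (Localization.AtPrime 𝔫.asIdeal)} ⊆
      (fun 𝔫 : PrimeSpectrum N => 𝔫.asIdeal) ⁻¹' (ca N).minimalPrimes := by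
    intro 𝔫 h𝔫
    refine ⟨⟨𝔫.2, (ca_le_iff_not_isRegularLocalRing k 𝔫.asIdeal).mpr h𝔫⟩, ?_⟩
    rintro q ⟨hq, hcaq⟩ hq𝔫
    haveI := hq
    have hqsing : ¬ IsRegularLocalRing (Localization.AtPrime q) :=
      (ca_le_iff_not_isRegularLocalRing k q).mp hcaq
    have hqmax : q.IsMaximal := isMaximal_of_not_isRegularLocalRing hdim q hqsing
    exact (hqmax.eq_of_le (Ideal.IsPrime.ne_top 𝔫.2) hq𝔫).ge
  refine Set.Finite.subset ?_ hsub
  exact (Ideal.finite_minimalPrimes_of_isNoetherianRing N (ca N)).preimage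
    fun _ _ _ _ h => PrimeSpectrum.ext h

end Finite

/-! ## Scheme form on `Spec N` -/

section Scheme

variable {N : Type} [CommRing N]

/-- `𝒪_{Spec N, 𝔫} ≅ N_𝔫`: a point of `Spec N` is in the regular locus iff `N_𝔫` is regular. [folklore] -/
theorem mem_regularLocus_Spec_iff (x : Spec (.of N)) :
    x ∈ Scheme.regularLocus (Spec (.of N)) ↔ IsRegularLocalRing (Localization.AtPrime x.asIdeal) := by
  letI : Algebra N ((Spec (.of N)).presheaf.stalk x) := (StructureSheaf.toStalk N x).hom.toAlgebra
  have hloc : IsLocalization.AtPrime ((Spec (.of N)).presheaf.stalk x) x.asIdeal :=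
    StructureSheaf.IsLocalization.to_stalk N x
  let e := (IsLocalization.algEquiv x.asIdeal.primeCompl ((Spec (.of N)).presheaf.stalk x)
    (Localization.AtPrime x.asIdeal)).toRingEquiv
  rw [Scheme.mem_regularLocus]
  exact ⟨fun h => IsRegularLocalRing.of_ringEquiv e, fun h => IsRegularLocalRing.of_ringEquiv e.symm⟩

variable [IsDomain N] [IsNoetherianRing N] [IsIntegrallyClosed N]

/-- **The singular locus of `Spec N` is finite** (`N` normal, `dim N ≤ 2`, essentially of finite type over a
field). [cite: IyengarTakahashi2014, Thm. 5.4] -/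
theorem finite_compl_regularLocus_Spec (k : Type) [Field k] [Algebra k N] [Algebra.EssFiniteType k N]
    (hdim : ringKrullDim N ≤ 2) : (Scheme.regularLocus (Spec (.of N)))ᶜ.Finite := by
  refine (finite_setOf_not_isRegularLocalRing k hdim).subset fun x hx => ?_
  have hx' : x ∉ Scheme.regularLocus (Spec (.of N)) := hx
  exact fun h => hx' ((mem_regularLocus_Spec_iff x).mpr h)

/-- **Singular points of `Spec N` are closed points** (`N` normal, `dim N ≤ 2`). [cite: Matsumura1987, Thm. 11.2] -/
theorem isClosed_singleton_of_not_mem_regularLocus_Spec (hdim : ringKrullDim N ≤ 2) (x : Spec (.of N))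
    (hx : x ∉ Scheme.regularLocus (Spec (.of N))) : IsClosed ({x} : Set (Spec (.of N))) := by
  rw [mem_regularLocus_Spec_iff] at hx
  exact (PrimeSpectrum.isClosed_singleton_iff_isMaximal x).mpr
    (isMaximal_of_not_isRegularLocalRing hdim x.asIdeal hx)

variable {T : Type} [CommRing T] [IsDomain T] [IsNoetherianRing T] [IsLocalRing T] [Algebra T N]
  [FaithfulSMul T N] [Algebra.FiniteType T N] [Algebra.IsAlgebraic T N]

/-- **Singular points of `Spec N` map to the closed point of `Spec T`** (under
`under_eq_maximalIdeal_of_not_isRegularLocalRing`'s hypotheses). [cite: Matsumura1987, Thm. 15.5] -/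
theorem specMap_apply_eq_closedPoint_of_not_mem_regularLocus (hT : ringKrullDim T ≤ 2)
    (x : Spec (.of N)) (hx : x ∉ Scheme.regularLocus (Spec (.of N))) :
    (Spec.map (CommRingCat.ofHom (algebraMap T N))) x = closedPoint T := by
  rw [mem_regularLocus_Spec_iff] at hx
  apply PrimeSpectrum.ext
  change (x.asIdeal).comap (algebraMap T N) = maximalIdeal T
  exact under_eq_maximalIdeal_of_not_isRegularLocalRing hT x.asIdeal hx

end Scheme

/-! ## Closed points over the closed point (Jacobson fibre) -/

section ClosedPoint

universe u

/-- **A locally closed point over a closed point is closed** for a morphism locally of finite type: if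
`f : X → Y` is locally of finite type, `y ∈ Y` is a closed point, and `x ∈ X` lies over `y` with `{x}`
locally closed in `X` (e.g. `x` closed in some open neighbourhood), then `{x}` is closed in `X` — the
fibre `X_y` is a Jacobson space (finite type over the field `κ(y)`), `{x}` is locally closed hence closed
in it, and `X_y → X` is a closed embedding.  Use: the images in the blowing up `B → Spec T` of the singular
points of the normalised chart are closed points of `B`. [this work] -/
theorem isClosed_singleton_of_isLocallyClosed_of_apply_eq {X Y : Scheme.{u}} (f : X ⟶ Y)
    [LocallyOfFiniteType f] {y : Y} (hy : IsClosed ({y} : Set Y)) {x : X} (hxy : f x = y)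
    (hx : IsLocallyClosed ({x} : Set X)) : IsClosed ({x} : Set X) := by
  have hrange : Set.range (f.fiberι y) = f ⁻¹' {y} := f.range_fiberι y
  have hxr : x ∈ Set.range (f.fiberι y) := by
    rw [hrange]
    exact hxy
  obtain ⟨x', hx'⟩ := hxr
  have hemb : Topology.IsClosedEmbedding (f.fiberι y) :=
    ⟨(f.fiberι y).isEmbedding, by rw [hrange]; exact hy.preimage f.continuous⟩
  have hpre : (f.fiberι y) ⁻¹' ({x} : Set X) = {x'} := by
    rw [← hx', ← Set.image_singleton, hemb.injective.preimage_image]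
  have hx'c : IsClosed ({x'} : Set ↥(f.fiber y)) :=
    isClosed_singleton_of_isLocallyClosed_singleton (hpre ▸ hx.preimage (f.fiberι y).continuous)
  have himg := hemb.isClosedMap _ hx'c
  rwa [Set.image_singleton, hx'] at himg

end ClosedPoint

end Summit.ResolutionOfSingularities.ResolutionOfSingularities.Theorems.SurfaceTermination.GenusDescent

end
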